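import Summits.QuantumFields.BalabanUV.T4Continuum.Spine.NE1p.DressedSmallFieldTBoxLetter
import Summits.QuantumFields.BalabanUV.T4Continuum.Spine.NE1p.DressedSmallFieldDecouplingExpansion

/-!
# T⁴ programme, spine estimate NE1′ (node O3b/H2) — (1.23) IN FULL ON PRINT's ANALYTICITY DOMAIN: the `t_□`-contour AROUND the
# `s`-INTEGRATED cube letters is `∂∕∂t_□|₀ Δ_S E = Δ_S (∂E∕∂t_□|₀)` — the `t_□`-derivative and the decoupling differences COMMUTE — for `E`
# analytic on a NEIGHBOURHOOD of `{|t_□| ≤ ρ} × Π_Δ{|σ(Δ)| ≤ r_Δ}` only (any `ρ > 0`); (1.24)'s THREE-FACTOR SHAPE `|t_□|⁻¹ · sup|E| ·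
# e^{−(κ₁−1)·#S}`; and the first `t_□`-variation of the COUPLED expression EXPANDS into exactly these letters ((1.10) → (1.23))

Cell `pub-balaban`, sub-cell `t4`, row NE1′ formalisation crew (`t4/formal/NE1p/LEAVES.md` row W89 ∕ DAG N29zzzzx, BOOKED typer R-T144 journal l.23862,
cap 340, X-read X228 — own-initiative DICTIONARY follower of the unit's W64 «THE t_□-CONTOUR OF (1.23)» and W78 «THE DECOUPLING EXPANSION RESUMS» under
R-T61 (ii); g12's NATURAL NEXT (a) taken through the `∫ ds(Δ)` and the bound), unit `b2b-balaban-t4-ne1p-formalise-leaf-08` (gen 13).  ADDITIVE — imports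
W64 `Spine/NE1p/DressedSmallFieldTBoxLetter` (`tBoxLetter_rep`, `norm_deriv_zero_le_tBoxLetter`) + W78 `Spine/NE1p/DressedSmallFieldDecouplingExpansion`
(`sum_mixedDiff_powerset`, `norm_apply_indicator_sub_apply_zero_le`) ONLY (→ W76 `mixedDiff_eq_sum_powerset`∕`mixedDiff_pair`; W74 «SplitLocal»
`mixedLetter_rep_of_split_local`∕`norm_mixedDiff_le_lemma19`; W57 `analyticOnNhd_cons_section_local`∕`differentiableOn_mixedDeriv_cons`∕`basePt_mem_pi`∕
`isOpen_polyBall`∕`mixedDerivLetter_rep_local`; W55 `enumS`∕`basePt`∕`θS`∕`pairθ`∕`analyticOnNhd_apply`; W39.1 `mixedDiff`∕`μS`∕`wS`∕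
`σS`; the NE5 substrate `Support/B13TermContours`: `w₁`, `circ`, `norm_circ`; the Literature module `Dimock2011to13/PolydiscCauchyBounds`: `mixedDeriv`,
`pderiv`, `polydisc`, `analyticOnNhd_pderiv` — all BY NAME).  THEOREMS ONLY + three `example`s; 0 `def`, 0 `instance`, 0 `def … : Prop`, 0 cite,
0 sorry, 0 `attribute`; nothing upstream restated (W64's ENTIRE `tBoxCubeLetter_rep` is NOT used: it is the special case `R = (ρ+1) ∷ (r+1)` of §3).

WHY THIS FILE.  [Balaban1988RGII] p. 7: «we extend the expression in (1.10) analytically with respect to t_□ satisfying |t_□|4B₀C₁e^{16κ₁}g_k|B| ≤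
½α₂. Taking t_□ for which the equality holds, we get (1.22) 1∕|t_□| = 8B₀C₁e^{16κ₁}α₂⁻¹g_k|B| < 8B₀C₁e^{16κ₁}α₂⁻¹ε₁», «Let us come back to the
expansion (1.10). We differentiate it with respect to t_□, at t_□ = 0, and we represent all derivatives by the Cauchy formula. The term in (1.10)
corresponding to a domain Y₀ is represented as (1.23) (1∕2πi)∮ dt_□∕t_□² Π_{Δ⊂Y₀∖□̃⁴} ∫ ds(Δ) (1∕2πi)∫ dσ(Δ)∕(σ(Δ) − s(Δ))² · E(□₀, (tζ̃_□ +
t_□ζ_□)H_k(σ(Y₀), B′)), where the t_□-integration is over the circle (1.22), and the σ(Δ)-integrations are over the circles |σ(Δ)| = e^{κ₁}», «We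
get (1.24) |(1.23)| ≤ 8B₀C₁e^{16κ₁}α₂⁻¹g_k|B| E₀(α₁∕α₃)⁵(L^jη)⁵ · exp(−(κ₁ − 1)M⁻⁴|Y₀∖□̃⁴|) exp(−κd_j(X))» — LOCI of the audited manuscript (render
p. 7 read as an image), TYPE∕CONTEXT only.  W64 read (1.23)'s operator AT FIXED `s` and for `E` JOINTLY ENTIRE; print's `E` is analytic only near
the SMALL `t_□`-disc (1.22) and the σ(Δ)-polydisc, and (1.23) carries the `∫ ds(Δ)`.  The lineage has every piece (W64's `t_□`-letter, «SplitLocal»'s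
`s`-integrated cube letters on print's domain, W76's closed form, W78's resummation) but not their COMPOSITION.  Here:
* §1 **`hasDerivAt_mixedDiff`∕`deriv_mixedDiff`: `∂∕∂t Δ_S (G t) = Δ_S (∂G∕∂t)`** under vertexwise differentiability — the `t_□`-derivative and
  the decoupling differences COMMUTE (W76's closed form: `Δ_S` is a finite signed sum of vertex values; Mathlib `HasDerivAt.fun_sum`);
* §2 sections of `E` analytic on the open polydisc `{|t| < R₀} × Π_j{|z_j| < R_{j+1}}` (`t_□` = coordinate `0`): `t ↦ E(t ∷ w)` and `t ↦ Δ_S E(t ∷ ·)`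
  holomorphic on the head disc; **`deriv_tSection_eq_pderiv`**: the first variation `∂E∕∂t|_{t₀}` IS the template's `pderiv 0 E`, hence
  (**`analyticOnNhd_deriv_tSection`**, `analyticOnNhd_pderiv` BY NAME) analytic in the cube variables;
* §3 **`tBoxMixedLetter_rep_local`**: for `0 < ρ < R₀`, `1 < r_j < R_{j+1}`, `∫_{θ_□} w₁ ρ (0,θ_□)·(∫ wS r S p·E(circ ρ θ_□ ∷ σ_S(p)) d(⨂ μS S)) dθ_□
  = ∂∕∂t|₀ Δ_S E(t ∷ ·)` — (1.23) IN FULL, the `∫ ds(Δ)` included, LOCAL hypotheses; **`tBoxMixedLetter_eq_mixedDiff_deriv_local`**: `= Δ_S(∂E∕∂t|₀)`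
  — THE (1.23) OBJECT IS THE DECOUPLING-EXPANSION TERM OF THE FIRST `t_□`-VARIATION; **`tBoxCubeLetter_rep_local`**: W64 §2's fixed-`s` form LOCALISED;
* §4 **`norm_deriv_mixedDiff_tSection_le`∕`norm_tBoxMixedLetter_le`: `|(1.23)| ≤ ρ⁻¹ · A · e^{−(κ₁−1)·#S}`** for `κ₁ ≥ 1`, `R_{j+1} > e^{κ₁}`, `‖E‖ ≤ A`
  on `{|t| = ρ} × {|z_j| ≤ e^{κ₁}}` (HYPOTHESIS of (1.21)∕(I.3.54) TYPE) — (1.24)'s three factors `1∕|t_□|` × sup × `exp(−(κ₁ − 1)·#cubes)` (W64's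
  letter cost on the circle, «SplitLocal» `norm_mixedDiff_le_lemma19` = Dimock's Lemma 19 BY NAME on every `t_□`-section); `norm_deriv_tSection_le`;
* §5 **`deriv_coupled_eq_sum_deriv_mixedDiff`∕`…_eq_sum_tBoxMixedLetter`: `∂∕∂t|₀ E(t ∷ 𝟙_S) = Σ_{T⊆S} ∂∕∂t|₀ Δ_T E(t ∷ ·) = Σ_{T⊆S} (1.23)_T`** —
  «we differentiate [the expansion (1.10)] with respect to t_□, at t_□ = 0» gives, term by term, the (1.23)'s (W78 on the first variation);
  **`norm_deriv_coupled_sub_decoupled_le`**: `‖∂_t|₀E(t ∷ 𝟙_S) − ∂_t|₀E(t ∷ 0)‖ ≤ ρ⁻¹·A·((1 + e^{−(κ₁−1)})^{#S} − 1)` (W78's geometric mechanism);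
* §6 decided checks on `E = (2 − t)⁻¹z₀z₁` (NOT entire in `t_□`; `t_□`-radius `1 < 2`, cube radii `3∕2 < 2`): the commutation alone and the full
  local letter both return `Δ_{01}(z₀z₁∕4) = 1∕4`.

HONEST FRAMING.  [folklore] one-variable Cauchy formula∕estimate (through W64) + finite combinatorics (W76∕W78) + the lineage's local contour analysis
BY NAME, on OUR dictionary objects and the template's kernel objects (`mixedDeriv`, `pderiv`); a DICTIONARY row — (1.23)'s composite operator and
(1.24)'s SHAPE on a decided scale, not an estimate of print: `E` ↔ print's `E(□₀, (tζ̃_□ + t_□ζ_□)H_k(σ(Y₀), B′))`, `ρ` ↔ `|t_□|` of (1.22) (symbolic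
letters `B₀, C₁, κ₁, α₂, g_k, |B|`, NONE instantiated), the cube radii ↔ `|σ(Δ)| = e^{κ₁}`, `#S` ↔ `M⁻⁴|Y₀∖□̃⁴|`, `𝟙_S`∕`0` ↔ coupled∕decoupled are
TYPE READINGS; «analytically with respect to t_□ satisfying |t_□|… ≤ ½α₂» is READ as analytic on an open set containing the closed disc (the
template's declared reading (i)); `A` is a HYPOTHESIS of (1.21)∕(I.3.54) TYPE; (I.3.54), E₀(α₁∕α₃)⁵(L^jη)⁵, exp(−κd_j(X)), (1.25) are NOT touched; no
numeral of [Balaban1988RGII] asserted (k2); (B1) for Bałaban's (2.14) NOT discharged; (B3) = GAPS G-ne9p2-5 UNPRINTED — NOT discharged, untouched;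
(B5) untouched; 0 binders instantiated on Bałaban's densities ∕ operators ∕ (2.14) data ∕ `d_k` ∕ minimisers ∕ backgrounds; discharges no wall item;
wall v1.8 (T4-DAG v48) does NOT move; R-t4r2-Q2 NOT met thereby; NE1′ ⇐ the named binders — NOT proved, NOT printed; spine PROVED 0∕9; count 9
unchanged.  Rung (B)+1 on ONE finite four-torus — NOT infinite volume, NOT a mass gap, NOT OS on ℝ⁴, NOT Clay.  ABSOLUTE RULE honoured: the
quotations are LOCI of the audited manuscript [Balaban1988RGII] (CMP 116 (1988) 1–22, p. 7), TYPE∕CONTEXT only, never hypothesis-free facts;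
[Dimock2013] enters only through the cite-tagged Literature module BY NAME; nothing internally minted is cited; [folklore] tags on kernel lemmas only.
HONEST DEPENDENCY: continuum YM on T⁴ ⇐ BetaPertH ∧ nine spine estimates (0/9 proved); BetaPertH ⇐ (D1) ∧ (D4) ∧ CAP+tail; G-an2-4 gates asym,
D1 and NE2/3/4.
-/

noncomputable section

namespace Summit.QuantumFields.BalabanUV.T4Continuum.NE1p.DressedSmallFieldTBoxMixedLetterLocal

open MeasureTheory Metric Set Complex Finset Function
open scoped BigOperators
open Summit.QuantumFields.BalabanUV.T4Continuum.B13TermContours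
open Summit.QuantumFields.BalabanUV.T4Continuum.NE1p.DressedSmallFieldMixedLetter
open Summit.QuantumFields.BalabanUV.T4Continuum.NE1p.DressedSmallFieldMixedDerivativeBridge
open Summit.QuantumFields.BalabanUV.T4Continuum.NE1p.DressedSmallFieldMixedDerivativeLetter
open Summit.QuantumFields.BalabanUV.T4Continuum.NE1p.DressedSmallFieldMixedDerivativeLetterLocal
open Summit.QuantumFields.BalabanUV.T4Continuum.NE1p.DressedSmallFieldMixedDerivativeSplitLocal
open Summit.QuantumFields.BalabanUV.T4Continuum.NE1p.DressedSmallFieldMixedDifferenceClosedForm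
open Summit.QuantumFields.BalabanUV.T4Continuum.NE1p.DressedSmallFieldTBoxLetter
open Summit.QuantumFields.BalabanUV.T4Continuum.NE1p.DressedSmallFieldDecouplingExpansion
open Literature.MathematicalPhysics.QuantumFieldTheory.Dimock2011to13.PolydiscCauchyBounds
  (mixedDeriv pderiv polydisc analyticOnNhd_pderiv)

variable {n : ℕ}

/-! ## §1 THE `t_□`-DERIVATIVE AND THE DECOUPLING DIFFERENCES COMMUTE -/

/-- **`∂_t Δ_S = Δ_S ∂_t`** [folklore]: for a `t`-dependent function `G t` of the cube variables, differentiable in `t` at `t₀` at every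
vertex `𝟙_T`, `T ⊆ S`, the mixed difference `t ↦ Δ_S (G t)` has derivative `Δ_S G'` at `t₀` whenever `G'` collects the vertex derivatives —
«ClosedForm» `mixedDiff_eq_sum_powerset` (a finite signed sum of vertex values) + Mathlib `HasDerivAt.fun_sum`. -/
theorem hasDerivAt_mixedDiff {G : ℂ → (Fin n → ℂ) → ℂ} {G' : (Fin n → ℂ) → ℂ} {t₀ : ℂ} (S : Finset (Fin n))
    (h : ∀ T ∈ S.powerset, HasDerivAt (fun t => G t (fun i => if i ∈ T then (1 : ℂ) else 0))
      (G' (fun i => if i ∈ T then (1 : ℂ) else 0)) t₀) :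
    HasDerivAt (fun t => mixedDiff n S (G t)) (mixedDiff n S G') t₀ := by
  have hfun : (fun t => mixedDiff n S (G t)) =
      fun t => ∑ T ∈ S.powerset, (-1 : ℂ) ^ (S.card - T.card) * G t (fun i => if i ∈ T then (1 : ℂ) else 0) := by
    funext t; rw [mixedDiff_eq_sum_powerset]
  rw [hfun, mixedDiff_eq_sum_powerset]
  exact HasDerivAt.fun_sum fun T hT => (h T hT).const_mul _

/-- **THE COMMUTATION `∂∕∂t|_{t₀} Δ_S (G t) = Δ_S (z ↦ ∂∕∂t|_{t₀} G t z)`** [folklore] under vertexwise differentiability. -/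
theorem deriv_mixedDiff {G : ℂ → (Fin n → ℂ) → ℂ} {t₀ : ℂ} (S : Finset (Fin n))
    (h : ∀ T ∈ S.powerset, DifferentiableAt ℂ (fun t => G t (fun i => if i ∈ T then (1 : ℂ) else 0)) t₀) :
    deriv (fun t => mixedDiff n S (G t)) t₀ = mixedDiff n S (fun z => deriv (fun t => G t z) t₀) :=
  (hasDerivAt_mixedDiff S (G' := fun z => deriv (fun t => G t z) t₀) fun T hT => (h T hT).hasDerivAt).deriv

/-- [folklore] … and `t ↦ Δ_S (G t)` is differentiable at `t₀`. -/
theorem differentiableAt_mixedDiff {G : ℂ → (Fin n → ℂ) → ℂ} {t₀ : ℂ} (S : Finset (Fin n))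
    (h : ∀ T ∈ S.powerset, DifferentiableAt ℂ (fun t => G t (fun i => if i ∈ T then (1 : ℂ) else 0)) t₀) :
    DifferentiableAt ℂ (fun t => mixedDiff n S (G t)) t₀ :=
  (hasDerivAt_mixedDiff S (G' := fun z => deriv (fun t => G t z) t₀) fun T hT => (h T hT).hasDerivAt).differentiableAt

/-! ## §2 Sections of a factor analytic on print's domain `{|t_□| < R₀} × Π_j {|σ_j| < R_{j+1}}` (the `t_□`-variable as coordinate `0`) -/

/-- [folklore] The vertices `𝟙_T` lie in the open polydisc of radii `> 1`. -/
theorem indicator_mem_pi {R : Fin n → ℝ} (hR1 : ∀ j, 1 < R j) (T : Finset (Fin n)) :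
    (fun i => if i ∈ T then (1 : ℂ) else 0) ∈ Set.univ.pi fun j => ball (0 : ℂ) (R j) :=
  Set.mem_univ_pi.2 fun j => mem_ball_zero_iff.2 (by
    by_cases h : j ∈ T
    · simpa [h] using hR1 j
    · simpa [h] using zero_lt_one.trans (hR1 j))

/-- [folklore] The `t_□`-section `t ↦ E(t ∷ w)` is holomorphic on the head disc for `w` in the tail polydisc (W57 `differentiableOn_mixedDeriv_cons`
at the EMPTY list: `∂_∅ = id`). -/
theorem differentiableOn_tSection {R : Fin (n + 1) → ℝ} {E : (Fin (n + 1) → ℂ) → ℂ}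
    (hE : AnalyticOnNhd ℂ E (Set.univ.pi fun j => ball (0 : ℂ) (R j))) {w : Fin n → ℂ}
    (hw : w ∈ Set.univ.pi fun j => ball (0 : ℂ) (Fin.tail R j)) :
    DifferentiableOn ℂ (fun t : ℂ => E (Fin.cons t w)) (ball (0 : ℂ) (R 0)) := by
  simpa using differentiableOn_mixedDeriv_cons hE [] hw

/-- [folklore] `t ↦ Δ_S E(t ∷ ·)` is holomorphic on the head disc `|t| < R₀` when the cube radii exceed `1` (§1 at every vertex). -/
theorem differentiableOn_mixedDiff_tSection {R : Fin (n + 1) → ℝ} (hR1 : ∀ j : Fin n, 1 < R j.succ) {E : (Fin (n + 1) → ℂ) → ℂ}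
    (hE : AnalyticOnNhd ℂ E (Set.univ.pi fun j => ball (0 : ℂ) (R j))) (S : Finset (Fin n)) :
    DifferentiableOn ℂ (fun t : ℂ => mixedDiff n S (fun w => E (Fin.cons t w))) (ball (0 : ℂ) (R 0)) := fun t ht =>
  (differentiableAt_mixedDiff S (G := fun t w => E (Fin.cons t w)) fun T _ =>
    ((differentiableOn_tSection hE (indicator_mem_pi hR1 T)) t ht).differentiableAt (isOpen_ball.mem_nhds ht)).differentiableWithinAt

/-- [folklore] The first `t_□`-variation `∂E∕∂t|_{t₀}(z)` IS Dimock's `pderiv 0 E` on the slice `t = t₀` (Mathlib `Fin.update_cons_zero`). -/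
theorem deriv_tSection_eq_pderiv (E : (Fin (n + 1) → ℂ) → ℂ) (w : Fin n → ℂ) (t₀ : ℂ) :
    deriv (fun t : ℂ => E (Fin.cons t w)) t₀ = pderiv 0 E (Fin.cons t₀ w) := by
  simp only [pderiv, Fin.update_cons_zero, Fin.cons_zero]

/-- **THE FIRST VARIATION IS ANALYTIC IN THE CUBE VARIABLES** [folklore]: `z ↦ ∂E∕∂t|₀(z)` is analytic on the tail polydisc — the template's
`analyticOnNhd_pderiv` (open set) BY NAME + W57's section lemma at the head value `0`. -/
theorem analyticOnNhd_deriv_tSection {R : Fin (n + 1) → ℝ} (hR0 : 0 < R 0) {E : (Fin (n + 1) → ℂ) → ℂ}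
    (hE : AnalyticOnNhd ℂ E (Set.univ.pi fun j => ball (0 : ℂ) (R j))) :
    AnalyticOnNhd ℂ (fun w : Fin n → ℂ => deriv (fun t : ℂ => E (Fin.cons t w)) 0)
      (Set.univ.pi fun j => ball (0 : ℂ) (Fin.tail R j)) := by
  have h : (fun w : Fin n → ℂ => deriv (fun t : ℂ => E (Fin.cons t w)) 0) = fun w => pderiv 0 E (Fin.cons 0 w) := by
    funext w; rw [deriv_tSection_eq_pderiv]
  rw [h]
  exact analyticOnNhd_cons_section_local (F := pderiv 0 E) (analyticOnNhd_pderiv (isOpen_polyBall R) hE 0) (by simpa using hR0)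

/-! ## §3 (1.23) IN FULL, LOCAL HYPOTHESES: the `t_□`-contour around the `s`-INTEGRATED cube letters -/

/-- **(1.23) IN FULL ON PRINT's ANALYTICITY DOMAIN** (kernel; «SplitLocal» `mixedLetter_rep_of_split_local` on every `t_□`-section `w ↦ E(τ ∷ w)`,
`τ = circ ρ θ_□` INSIDE the head disc — W57 `analyticOnNhd_cons_section_local` — then W64's `tBoxLetter_rep` on the holomorphic
`t ↦ Δ_S E(t ∷ ·)` of §2): for the `t_□`-circle radius `0 < ρ < R₀`, cube contour radii `1 < r_j < R_{j+1}` and `E` JOINTLY ANALYTIC ON THE OPEN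
POLYDISC `{|t| < R₀} × Π_j{|σ_j| < R_{j+1}}` ONLY,
`∫_{θ_□} w₁ ρ (0,θ_□) · (∫ wS r S p · E(circ ρ θ_□ ∷ σ_S(p)) d(⨂_j μS S j)(p)) dθ_□ = ∂∕∂t|₀ Δ_S E(t ∷ ·)` — [Balaban1988RGII] (1.23) p. 7
«(1∕2πi)∮ dt_□∕t_□² Π_{Δ⊂Y₀∖□̃⁴} ∫ ds(Δ) (1∕2πi)∫ dσ(Δ)∕(σ(Δ) − s(Δ))² · E(…)» (t_□-circle (1.22), SMALL; σ(Δ)-circles `|σ(Δ)| = e^{κ₁}`), WITH the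
`∫ ds(Δ)` (W64 §2 read it at fixed `s` and for `E` entire) — TYPE∕CONTEXT. [folklore] -/
theorem tBoxMixedLetter_rep_local {ρ : ℝ} (hρ : 0 < ρ) {r : Fin n → ℝ} {R : Fin (n + 1) → ℝ} (hρR : ρ < R 0)
    (hr : ∀ j, 1 < r j) (hrR : ∀ j : Fin n, r j < R j.succ) (S : Finset (Fin n)) {E : (Fin (n + 1) → ℂ) → ℂ}
    (hE : AnalyticOnNhd ℂ E (Set.univ.pi fun j => ball (0 : ℂ) (R j))) :
    ∫ θ₀ in Icc 0 (2 * Real.pi), w₁ ρ (0, θ₀) *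
        ∫ p, wS r S p * E (Fin.cons (circ ρ θ₀) (σS r S p)) ∂(Measure.pi (μS S)) =
      deriv (fun t : ℂ => mixedDiff n S (fun w => E (Fin.cons t w))) 0 := by
  have hinner : ∀ θ₀ : ℝ, ∫ p, wS r S p * E (Fin.cons (circ ρ θ₀) (σS r S p)) ∂(Measure.pi (μS S)) =
      mixedDiff n S (fun w => E (Fin.cons (circ ρ θ₀) w)) := fun θ₀ =>
    mixedLetter_rep_of_split_local hr hrR S _
      (analyticOnNhd_cons_section_local hE (by rw [norm_circ hρ.le]; exact hρR))
  simp_rw [hinner]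
  exact tBoxLetter_rep hρ isOpen_ball (closedBall_subset_ball hρR)
    (differentiableOn_mixedDiff_tSection (fun j => (hr j).trans (hrR j)) hE S)

/-- **… `= Δ_S (∂E∕∂t_□|₀)`** — THE (1.23) OBJECT IS THE DECOUPLING-EXPANSION TERM OF THE FIRST `t_□`-VARIATION (§3 + the commutation §1). [folklore] -/
theorem tBoxMixedLetter_eq_mixedDiff_deriv_local {ρ : ℝ} (hρ : 0 < ρ) {r : Fin n → ℝ} {R : Fin (n + 1) → ℝ} (hρR : ρ < R 0)
    (hr : ∀ j, 1 < r j) (hrR : ∀ j : Fin n, r j < R j.succ) (S : Finset (Fin n)) {E : (Fin (n + 1) → ℂ) → ℂ}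
    (hE : AnalyticOnNhd ℂ E (Set.univ.pi fun j => ball (0 : ℂ) (R j))) :
    ∫ θ₀ in Icc 0 (2 * Real.pi), w₁ ρ (0, θ₀) *
        ∫ p, wS r S p * E (Fin.cons (circ ρ θ₀) (σS r S p)) ∂(Measure.pi (μS S)) =
      mixedDiff n S (fun w => deriv (fun t : ℂ => E (Fin.cons t w)) 0) := by
  rw [tBoxMixedLetter_rep_local hρ hρR hr hrR S hE]
  have h0 : (0 : ℂ) ∈ ball (0 : ℂ) (R 0) := mem_ball_self (hρ.trans hρR)
  exact deriv_mixedDiff S (G := fun t w => E (Fin.cons t w)) fun T _ =>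
    ((differentiableOn_tSection hE (indicator_mem_pi (fun j => (hr j).trans (hrR j)) T)) 0 h0).differentiableAt
      (isOpen_ball.mem_nhds h0)

/-- **W64 §2 LOCALISED** (the derivative form at a fixed interpolation point `s ∈ [0,1]^S`; W57 `mixedDerivLetter_rep_local` on every
`t_□`-section + `tBoxLetter_rep` on W57's `differentiableOn_mixedDeriv_cons`): under the same LOCAL hypotheses,
`∫_{θ_□} w₁ ρ (0,θ_□) · (∫ wS r S (s,θ)·E(circ ρ θ_□ ∷ σ_S(s,θ)) d(⨂ θS S)) dθ_□ = ∂∕∂t|₀ ∂_{enumS S}(E(t ∷ ·))(basePt S s)` — W64's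
`tBoxCubeLetter_rep` had `E` JOINTLY ENTIRE. [folklore] -/
theorem tBoxCubeLetter_rep_local {ρ : ℝ} (hρ : 0 < ρ) {r : Fin n → ℝ} {R : Fin (n + 1) → ℝ} (hρR : ρ < R 0)
    (hr : ∀ j, 1 < r j) (hrR : ∀ j : Fin n, r j < R j.succ) (S : Finset (Fin n)) {E : (Fin (n + 1) → ℂ) → ℂ}
    (hE : AnalyticOnNhd ℂ E (Set.univ.pi fun j => ball (0 : ℂ) (R j))) (s : Fin n → ℝ) (hs : ∀ j ∈ S, s j ∈ Icc (0 : ℝ) 1) :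
    ∫ θ₀ in Icc 0 (2 * Real.pi), w₁ ρ (0, θ₀) *
        ∫ θ, wS r S (pairθ s θ) * E (Fin.cons (circ ρ θ₀) (σS r S (pairθ s θ))) ∂(Measure.pi (θS S)) =
      deriv (fun t : ℂ => mixedDeriv (enumS n S) (fun w => E (Fin.cons t w)) (basePt S s)) 0 := by
  have hinner : ∀ θ₀ : ℝ, ∫ θ, wS r S (pairθ s θ) * E (Fin.cons (circ ρ θ₀) (σS r S (pairθ s θ))) ∂(Measure.pi (θS S)) =
      mixedDeriv (enumS n S) (fun w => E (Fin.cons (circ ρ θ₀) w)) (basePt S s) := fun θ₀ =>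
    mixedDerivLetter_rep_local n r (Fin.tail R) S _ s hr hrR
      (analyticOnNhd_cons_section_local hE (by rw [norm_circ hρ.le]; exact hρR)) hs
  simp_rw [hinner]
  exact tBoxLetter_rep hρ isOpen_ball (closedBall_subset_ball hρR)
    (differentiableOn_mixedDeriv_cons hE (enumS n S) (basePt_mem_pi (fun j => (hr j).trans (hrR j)) S hs))

/-- [folklore] W64 §2's ENTIRE statement `tBoxCubeLetter_rep` is the special case `R = (ρ + 1) ∷ (r + 1)` of the local one (census: W64's
theorem is NOT used in this file). -/
example {ρ : ℝ} (hρ : 0 < ρ) (r : Fin n → ℝ) (hr : ∀ j, 1 < r j) (S : Finset (Fin n)) {E : (Fin (n + 1) → ℂ) → ℂ}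
    (hE : AnalyticOnNhd ℂ E univ) (s : Fin n → ℝ) (hs : ∀ j ∈ S, s j ∈ Icc (0 : ℝ) 1) :
    ∫ θ₀ in Icc 0 (2 * Real.pi), w₁ ρ (0, θ₀) *
        ∫ θ, wS r S (pairθ s θ) * E (Fin.cons (circ ρ θ₀) (σS r S (pairθ s θ))) ∂(Measure.pi (θS S)) =
      deriv (fun t : ℂ => mixedDeriv (enumS n S) (fun w => E (Fin.cons t w)) (basePt S s)) 0 :=
  tBoxCubeLetter_rep_local hρ (R := Fin.cons (ρ + 1) fun j => r j + 1) (by simp) hr (fun j => by simp) S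
    (hE.mono (subset_univ _)) s hs

/-! ## §4 (1.24)'s THREE-FACTOR SHAPE: `|t_□|⁻¹ · sup|E| · e^{−(κ₁−1)·#S}` -/

/-- **THE FIRST VARIATION COSTS `|t_□|⁻¹ · sup|E|`** [folklore] (W64 `norm_deriv_zero_le_tBoxLetter` on the `t_□`-section): for `z` in the
closed polydisc `|z_j| ≤ e^{κ₁}` (inside the open one) and `‖E‖ ≤ A` on `{|t| = ρ} × {|z_j| ≤ e^{κ₁}}` (a HYPOTHESIS of (1.21) TYPE),
`‖∂E∕∂t|₀(z)‖ ≤ ρ⁻¹·A`. -/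
theorem norm_deriv_tSection_le {ρ : ℝ} (hρ : 0 < ρ) {R : Fin (n + 1) → ℝ} (hρR : ρ < R 0) {κ₁ A : ℝ}
    (hR : ∀ j : Fin n, Real.exp κ₁ < R j.succ) {E : (Fin (n + 1) → ℂ) → ℂ} (hE : AnalyticOnNhd ℂ E (Set.univ.pi fun j => ball (0 : ℂ) (R j)))
    (hA : ∀ t : ℂ, ‖t‖ = ρ → ∀ z ∈ polydisc (fun _ : Fin n => Real.exp κ₁), ‖E (Fin.cons t z)‖ ≤ A)
    {z : Fin n → ℂ} (hz : z ∈ polydisc (fun _ : Fin n => Real.exp κ₁)) :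
    ‖deriv (fun t : ℂ => E (Fin.cons t z)) 0‖ ≤ ρ⁻¹ * A :=
  norm_deriv_zero_le_tBoxLetter hρ isOpen_ball (closedBall_subset_ball hρR)
    (differentiableOn_tSection hE (Set.mem_univ_pi.2 fun j => mem_ball_zero_iff.2 (lt_of_le_of_lt (hz j) (hR j))))
    fun θ => hA _ (norm_circ hρ.le θ) z hz

/-- **(1.24)'s SHAPE** [folklore] (W64 `norm_deriv_zero_le_tBoxLetter` on §2's holomorphic `t ↦ Δ_S E(t ∷ ·)`, its circle bound supplied by
«SplitLocal» `norm_mixedDiff_le_lemma19` — Dimock's Lemma 19 BY NAME — on every `t_□`-section): for `1 ≤ κ₁`, cube radii `R_{j+1} > e^{κ₁}`, the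
`t_□`-radius `0 < ρ < R₀`, `E` analytic on the open polydisc and `‖E‖ ≤ A` on `{|t| = ρ} × {|z_j| ≤ e^{κ₁}}` (HYPOTHESIS of (1.21) TYPE),
`‖∂∕∂t|₀ Δ_S E(t ∷ ·)‖ ≤ ρ⁻¹ · A · e^{−(κ₁−1)·#S}` — [Balaban1988RGII] (1.24) p. 7 «|(1.23)| ≤ 8B₀C₁e^{16κ₁}α₂⁻¹g_k|B| · E₀(…)(L^jη)⁵ ·
exp(−(κ₁ − 1)M⁻⁴|Y₀∖□̃⁴|) exp(−κd_j(X))»: the factor `1∕|t_□|` (1.22) × the sup of `E` × the decay per decoupled cube — TYPE, its letters symbolic. -/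
theorem norm_deriv_mixedDiff_tSection_le {ρ : ℝ} (hρ : 0 < ρ) {R : Fin (n + 1) → ℝ} (hρR : ρ < R 0) {κ₁ A : ℝ} (hκ : 1 ≤ κ₁)
    (hR : ∀ j : Fin n, Real.exp κ₁ < R j.succ) (S : Finset (Fin n)) {E : (Fin (n + 1) → ℂ) → ℂ}
    (hE : AnalyticOnNhd ℂ E (Set.univ.pi fun j => ball (0 : ℂ) (R j)))
    (hA : ∀ t : ℂ, ‖t‖ = ρ → ∀ z ∈ polydisc (fun _ : Fin n => Real.exp κ₁), ‖E (Fin.cons t z)‖ ≤ A) :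
    ‖deriv (fun t : ℂ => mixedDiff n S (fun w => E (Fin.cons t w))) 0‖ ≤ ρ⁻¹ * (A * Real.exp (-((κ₁ - 1) * S.card))) := by
  have h1 : ∀ j : Fin n, 1 < R j.succ := fun j => lt_trans (by have := Real.add_one_le_exp κ₁; linarith) (hR j)
  refine norm_deriv_zero_le_tBoxLetter hρ isOpen_ball (closedBall_subset_ball hρR)
    (differentiableOn_mixedDiff_tSection h1 hE S) fun θ => ?_
  have hc : ‖circ ρ θ‖ < R 0 := by rw [norm_circ hρ.le]; exact hρR
  exact norm_mixedDiff_le_lemma19 hκ hR S (analyticOnNhd_cons_section_local hE hc) fun z hz => hA _ (norm_circ hρ.le θ) z hz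

/-- **(1.24)'s SHAPE FOR THE LETTER ITSELF** (§3 + the previous bound): `|(1.23)| ≤ |t_□|⁻¹ · A · e^{−(κ₁−1)·#S}` for contour radii
`1 < r_j < R_{j+1}`. [folklore] -/
theorem norm_tBoxMixedLetter_le {ρ : ℝ} (hρ : 0 < ρ) {r : Fin n → ℝ} {R : Fin (n + 1) → ℝ} (hρR : ρ < R 0) (hr : ∀ j, 1 < r j)
    (hrR : ∀ j : Fin n, r j < R j.succ) {κ₁ A : ℝ} (hκ : 1 ≤ κ₁) (hR : ∀ j : Fin n, Real.exp κ₁ < R j.succ) (S : Finset (Fin n))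
    {E : (Fin (n + 1) → ℂ) → ℂ} (hE : AnalyticOnNhd ℂ E (Set.univ.pi fun j => ball (0 : ℂ) (R j)))
    (hA : ∀ t : ℂ, ‖t‖ = ρ → ∀ z ∈ polydisc (fun _ : Fin n => Real.exp κ₁), ‖E (Fin.cons t z)‖ ≤ A) :
    ‖∫ θ₀ in Icc 0 (2 * Real.pi), w₁ ρ (0, θ₀) *
        ∫ p, wS r S p * E (Fin.cons (circ ρ θ₀) (σS r S p)) ∂(Measure.pi (μS S))‖ ≤
      ρ⁻¹ * (A * Real.exp (-((κ₁ - 1) * S.card))) := by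
  rw [tBoxMixedLetter_rep_local hρ hρR hr hrR S hE]
  exact norm_deriv_mixedDiff_tSection_le hρ hρR hκ hR S hE hA

/-! ## §5 THE FIRST VARIATION OF THE COUPLED EXPRESSION EXPANDS — its terms are the (1.23)'s ((1.10) → (1.23)) -/

/-- **`∂∕∂t|₀ E(t ∷ 𝟙_S) = Σ_{T ⊆ S} ∂∕∂t|₀ Δ_T E(t ∷ ·)`** [folklore] («DecouplingExpansion» `sum_mixedDiff_powerset` on the first variation + the
commutation §1 termwise; hypothesis: `t ↦ E(t ∷ 𝟙_T)` differentiable at `0` at every vertex): differentiating the COUPLED expression «with respect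
to t_□, at t_□ = 0» (p. 7) and expanding in the active cubes gives the sum over `T ⊆ S` of the `∂_t|₀ Δ_T` — print's passage from the expansion
(1.10) to its differentiated terms (1.23), TYPE. -/
theorem deriv_coupled_eq_sum_deriv_mixedDiff (S : Finset (Fin n)) {E : (Fin (n + 1) → ℂ) → ℂ}
    (h : ∀ T ∈ S.powerset, DifferentiableAt ℂ (fun t : ℂ => E (Fin.cons t (fun i => if i ∈ T then (1 : ℂ) else 0))) 0) :
    deriv (fun t : ℂ => E (Fin.cons t (fun i => if i ∈ S then (1 : ℂ) else 0))) 0 =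
      ∑ T ∈ S.powerset, deriv (fun t : ℂ => mixedDiff n T (fun w => E (Fin.cons t w))) 0 := by
  have hd : ∀ T ∈ S.powerset, deriv (fun t : ℂ => mixedDiff n T (fun w => E (Fin.cons t w))) 0 =
      mixedDiff n T (fun w => deriv (fun t : ℂ => E (Fin.cons t w)) 0) := fun T hT =>
    deriv_mixedDiff T (G := fun t w => E (Fin.cons t w)) fun T' hT' =>
      h T' (mem_powerset.2 ((mem_powerset.1 hT').trans (mem_powerset.1 hT)))
  rw [sum_congr rfl hd, sum_mixedDiff_powerset]

/-- **… AND IN CONTOUR FORM: `∂∕∂t|₀ E(t ∷ 𝟙_S) = Σ_{T ⊆ S} (1.23)_T`** [folklore] (the previous identity + §3 termwise): for the `t_□`-radius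
`0 < ρ < R₀` and contour radii `1 < r_j < R_{j+1}`, the first variation of the coupled expression is the sum over the active sets `T ⊆ S` of the
double contour letters. -/
theorem deriv_coupled_eq_sum_tBoxMixedLetter {ρ : ℝ} (hρ : 0 < ρ) {r : Fin n → ℝ} {R : Fin (n + 1) → ℝ} (hρR : ρ < R 0)
    (hr : ∀ j, 1 < r j) (hrR : ∀ j : Fin n, r j < R j.succ) (S : Finset (Fin n)) {E : (Fin (n + 1) → ℂ) → ℂ}
    (hE : AnalyticOnNhd ℂ E (Set.univ.pi fun j => ball (0 : ℂ) (R j))) :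
    deriv (fun t : ℂ => E (Fin.cons t (fun i => if i ∈ S then (1 : ℂ) else 0))) 0 =
      ∑ T ∈ S.powerset, ∫ θ₀ in Icc 0 (2 * Real.pi), w₁ ρ (0, θ₀) *
        ∫ p, wS r T p * E (Fin.cons (circ ρ θ₀) (σS r T p)) ∂(Measure.pi (μS T)) := by
  have h0 : (0 : ℂ) ∈ ball (0 : ℂ) (R 0) := mem_ball_self (hρ.trans hρR)
  rw [deriv_coupled_eq_sum_deriv_mixedDiff S fun T _ =>
    ((differentiableOn_tSection hE (indicator_mem_pi (fun j => (hr j).trans (hrR j)) T)) 0 h0).differentiableAt (isOpen_ball.mem_nhds h0)]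
  exact sum_congr rfl fun T _ => (tBoxMixedLetter_rep_local hρ hρR hr hrR T hE).symm

/-- **THE TERMS WITH AT LEAST ONE ACTIVE CUBE, BOUNDED** [folklore] («DecouplingExpansion» `norm_apply_indicator_sub_apply_zero_le` applied to
the first variation `z ↦ ∂E∕∂t|₀(z)` — analytic on the tail polydisc (§2) and bounded by `ρ⁻¹·A` on `|z_j| ≤ e^{κ₁}` (§4)):
`‖∂∕∂t|₀ E(t ∷ 𝟙_S) − ∂∕∂t|₀ E(t ∷ 0)‖ ≤ ρ⁻¹·A·((1 + e^{−(κ₁−1)})^{#S} − 1)` — the geometric convergence of the expanded first variation on a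
decided scale (print's polymer combinatorics NOT touched). -/
theorem norm_deriv_coupled_sub_decoupled_le {ρ : ℝ} (hρ : 0 < ρ) {R : Fin (n + 1) → ℝ} (hρR : ρ < R 0) {κ₁ A : ℝ} (hκ : 1 ≤ κ₁)
    (hR : ∀ j : Fin n, Real.exp κ₁ < R j.succ) (S : Finset (Fin n)) {E : (Fin (n + 1) → ℂ) → ℂ}
    (hE : AnalyticOnNhd ℂ E (Set.univ.pi fun j => ball (0 : ℂ) (R j)))
    (hA : ∀ t : ℂ, ‖t‖ = ρ → ∀ z ∈ polydisc (fun _ : Fin n => Real.exp κ₁), ‖E (Fin.cons t z)‖ ≤ A) :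
    ‖deriv (fun t : ℂ => E (Fin.cons t (fun i => if i ∈ S then (1 : ℂ) else 0))) 0 - deriv (fun t : ℂ => E (Fin.cons t 0)) 0‖ ≤
      ρ⁻¹ * A * ((1 + Real.exp (-(κ₁ - 1))) ^ S.card - 1) :=
  norm_apply_indicator_sub_apply_zero_le (F := fun w : Fin n → ℂ => deriv (fun t : ℂ => E (Fin.cons t w)) 0) hκ hR S
    (analyticOnNhd_deriv_tSection (hρ.trans hρR) hE) fun _ hz => norm_deriv_tSection_le hρ hρR hR hE hA hz

/-! ## §6 Decided checks -/

/-- [folklore] The decided datum `E(t, z₀, z₁) = (2 − t)⁻¹·z₀z₁` is JOINTLY ANALYTIC on the open polydisc `{|t| < 2} × {|z_j| < 2}` (not beyond `t = 2`). -/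
theorem analyticOnNhd_inv_two_sub_mul :
    AnalyticOnNhd ℂ (fun v : Fin 3 → ℂ => (2 - v 0)⁻¹ * (v (Fin.succ 0) * v (Fin.succ 1))) (Set.univ.pi fun _ : Fin 3 => ball (0 : ℂ) 2) := by
  intro v hv
  have h0 : ‖v 0‖ < 2 := by simpa using (Set.mem_univ_pi.1 hv) 0
  have hne : (2 : ℂ) - v 0 ≠ 0 := by
    intro h
    have h' : v 0 = 2 := (sub_eq_zero.1 h).symm
    rw [h'] at h0
    norm_num at h0
  exact ((analyticAt_const.sub (analyticOnNhd_apply 0 v (mem_univ _))).inv hne).mul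
    ((analyticOnNhd_apply (Fin.succ 0) v (mem_univ _)).mul (analyticOnNhd_apply (Fin.succ 1) v (mem_univ _)))

/-- DECIDED CHECK (the commutation §1 alone): `∂∕∂t|₀ Δ_{01}((2 − t)⁻¹ z₀z₁) = Δ_{01}(z₀z₁∕4) = 1∕4`. -/
example : deriv (fun t : ℂ => mixedDiff 2 {0, 1} (fun w => (2 - t)⁻¹ * (w 0 * w 1))) 0 = 1 / 4 := by
  have hd : ∀ w : Fin 2 → ℂ, HasDerivAt (fun t : ℂ => (2 - t)⁻¹ * (w 0 * w 1)) (-(0 - 1) / (2 - 0) ^ 2 * (w 0 * w 1)) 0 := fun w =>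
    (((hasDerivAt_const (0 : ℂ) (2 : ℂ)).fun_sub (hasDerivAt_id (0 : ℂ))).fun_inv (by norm_num)).mul_const (w 0 * w 1)
  rw [deriv_mixedDiff {0, 1} (G := fun t w => (2 - t)⁻¹ * (w 0 * w 1)) fun T _ =>
    (hd fun i => if i ∈ T then (1 : ℂ) else 0).differentiableAt]
  simp_rw [(hd _).deriv, mixedDiff_pair]
  norm_num

/-- DECIDED CHECK (the FULL local letter; `E = (2 − t)⁻¹ z₀z₁` NOT entire in `t_□`, `t_□`-radius `1 < 2`, cube contour radii `3∕2 < 2`, both cubes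
active): the `t_□`-contour around the `s`-integrated cube letters returns `Δ_{01}(∂_t E|₀) = Δ_{01}(z₀z₁∕4) = 1∕4` — §3 on print's-type domain. -/
example : ∫ θ₀ in Icc 0 (2 * Real.pi), w₁ 1 (0, θ₀) *
    ∫ p : Fin 2 → ℝ × ℝ, wS (fun _ => (3 / 2 : ℝ)) {0, 1} p *
      ((2 - circ 1 θ₀)⁻¹ * (σS (fun _ => (3 / 2 : ℝ)) {0, 1} p 0 * σS (fun _ => (3 / 2 : ℝ)) {0, 1} p 1)) ∂(Measure.pi (μS {0, 1})) = 1 / 4 := by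
  have h := tBoxMixedLetter_eq_mixedDiff_deriv_local (n := 2) (ρ := 1) one_pos (r := fun _ => 3 / 2) (R := fun _ => 2) (by norm_num)
    (fun _ => by norm_num) (fun _ => by norm_num) {0, 1} analyticOnNhd_inv_two_sub_mul
  simp only [Fin.cons_zero, Fin.cons_succ] at h
  rw [h]
  have hd : ∀ w : Fin 2 → ℂ, HasDerivAt (fun t : ℂ => (2 - t)⁻¹ * (w 0 * w 1)) (-(0 - 1) / (2 - 0) ^ 2 * (w 0 * w 1)) 0 := fun w =>
    (((hasDerivAt_const (0 : ℂ) (2 : ℂ)).fun_sub (hasDerivAt_id (0 : ℂ))).fun_inv (by norm_num)).mul_const (w 0 * w 1)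
  simp_rw [(hd _).deriv, mixedDiff_pair]
  norm_num

end Summit.QuantumFields.BalabanUV.T4Continuum.NE1p.DressedSmallFieldTBoxMixedLetterLocal

end
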